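import Mathlib
import Literature.Analysis.FluidPDE.TypeIICoreWitness
import Summits.NavierStokesRegularity.NavierStokesRegularity.Theorems.TypeIIInviscidRelaxationCoreExclusionAnchorReductionColumnar
import Summits.NavierStokesRegularity.NavierStokesRegularity.Theorems.TypeIIInviscidRelaxationCoreExclusionAnchorReductionAxisym
import HarnessLib

/-!
# Route `TypeIIInviscidRelaxation`, cruxes `MonopoleCoreExclusion` (stmt-1965) / `ColumnarCoreExclusion` (stmt-1966):
# the LATE-FLOOR variant of the exclusion half of the route, assembled — disjunctive late-floor witnesses are excluded
# by the two shadowing stubs (plus the landed constructions)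

`--supports stmt-NavierStokesRegularity-1966` (helper file; theorems only, no definitions, no `sorry`; outside the
import cone of the route file).

The route's relaxation crux produces, for a non-Type-I blow-up, core witnesses of the DISJUNCTIVE class
"axisymmetric or columnar" at every level frequently before `T`; `TypeIICoreWitness.frequently_or` splits them into
one class, and the two exclusion cruxes kill each class.  The registered lines of the exclusion cruxes need their
witnesses LATE (`(T-t)V ≤ KL`) and — by the reduction `anchoredLateWitness_of_lateWitnesses_radiusFloor` of this
hand — with a CORE-RADIUS FLOOR `r₀ ≤ KL`; given that, anchoring and the singular anchor are proved, and each
late-floor crux follows from its shadowing stub (`columnarCoreExclusion_lateFloor_of_shadowing`,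
`monopoleCoreExclusion_lateFloor_of_shadowing`).  This file assembles the late-floor variant of the whole
exclusion half:

* `witness_of_level_le` — level descent `K' ↦ K ≤ K'` of a class-`C` witness by `L' = (K'/K)L`, `W' = W((K'/K)·)`
  with the core radius preserved, `K·L' = K'·L` (so lateness, floors and anchoring descend);
* `lateFloorWitnesses_frequently_or` — the disjunctive split for LATE-FLOOR witnesses (the analogue of
  `TypeIICoreWitness.frequently_or`; the late and floor clauses are not antitone in the level for fixed data, the
  descent above repairs this);
* `lateFloorCoreExclusion_of_shadowings` — given the conclusion of the landed axisymmetric transfer stub (hypothesis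
  `hComp`, = `AxisymComparisonFlow.stub_axisymComparisonFlowOfAX hAX`, p830482) and the statements of the two
  registered shadowing stubs (`hShadowAx` = `stub_axisymShadowing`, `hShadowCol` = `stub_columnarShadowing`,
  verbatim), NO maximal smooth Leray–Hopf solution from a rapidly decaying datum carries late (axisymmetric-or-columnar)
  core witnesses with a core-radius floor at every level frequently before `T`.

So a re-lined exclusion half with currency "late witnesses with a radius floor" has exactly the research residues
{relaxation WITH lateness and floor, `stub_axisymShadowing`, `stub_columnarShadowing`, `AxisymSwirlRegular`}.
Nothing about Navier–Stokes regularity is claimed; no crux is proved here.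
-/

noncomputable section

open Set Metric MeasureTheory Function Filter Topology
open Literature.Analysis Literature.Analysis.FluidPDE
open scoped ENNReal

namespace Summit.NavierStokesRegularity.NavierStokesRegularity.Theorems

-- the problem directory repeats the summit name (`NavierStokesRegularity/NavierStokesRegularity`)
set_option linter.dupNamespace false

namespace CoreExclusionAnchor

/-! ### §1 Level descent with preserved core radius -/

/-- **Level descent of a core witness with the core radius preserved.**  A level-`K'` witness `(x₀, L, V, Q, W)` of a
dilation-stable class `C` for the slice `u t` yields, for `0 < K ≤ K'`, a level-`K` witness with the same centre,
speed bound and frame, core length `L' = (K'/K)L`, profile `W' = W((K'/K)·)`, and `K·L' = K'·L` (so every clause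
monotone in the core radius — lateness `(T-t)V ≤ K·L`, a floor `r₀ ≤ K·L`, anchoring `dist xs x₀ ≤ K·L/4` —
descends unchanged). [folklore] -/
theorem witness_of_level_le {C : (EuclideanSpace ℝ (Fin 3) → EuclideanSpace ℝ (Fin 3)) → Prop}
    (hC : ∀ W, C W → ∀ c : ℝ, 1 ≤ c → C (fun y => W (c • y)))
    {ν K K' t L V : ℝ} {u : ℝ → EuclideanSpace ℝ (Fin 3) → EuclideanSpace ℝ (Fin 3)}
    {x₀ : EuclideanSpace ℝ (Fin 3)}
    {Q : EuclideanSpace ℝ (Fin 3) ≃ₗᵢ[ℝ] EuclideanSpace ℝ (Fin 3)}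
    {W : EuclideanSpace ℝ (Fin 3) → EuclideanSpace ℝ (Fin 3)}
    (hν : 0 ≤ ν) (hK : 0 < K) (hKK' : K ≤ K') (hL : 0 < L) (hV : 0 < V) (hW : C W)
    (hnear : ∃ x₁, dist x₁ x₀ ≤ L ∧ V ≤ 2 * ‖u t x₁‖)
    (hosc : ∃ y y' : EuclideanSpace ℝ (Fin 3), ‖y‖ ≤ 1 ∧ ‖y'‖ ≤ 1 ∧ (4 : ℝ)⁻¹ ≤ ‖W y - W y'‖)
    (hRe : K' * ν ≤ L * V)
    (hclose : ∀ y : EuclideanSpace ℝ (Fin 3), ‖y‖ ≤ K' →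
      ‖V⁻¹ • Q.symm (u t (x₀ + L • Q y)) - W y‖ ≤ K'⁻¹) :
    ∃ (L' : ℝ) (W' : EuclideanSpace ℝ (Fin 3) → EuclideanSpace ℝ (Fin 3)),
      0 < L' ∧ C W' ∧
      (∃ x₁, dist x₁ x₀ ≤ L' ∧ V ≤ 2 * ‖u t x₁‖) ∧
      (∃ y y' : EuclideanSpace ℝ (Fin 3), ‖y‖ ≤ 1 ∧ ‖y'‖ ≤ 1 ∧ (4 : ℝ)⁻¹ ≤ ‖W' y - W' y'‖) ∧
      K * ν ≤ L' * V ∧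
      (∀ y : EuclideanSpace ℝ (Fin 3), ‖y‖ ≤ K →
        ‖V⁻¹ • Q.symm (u t (x₀ + L' • Q y)) - W' y‖ ≤ K⁻¹) ∧
      K * L' = K' * L := by
  set c : ℝ := K' / K with hc
  have hc1 : 1 ≤ c := by rw [hc, le_div_iff₀ hK, one_mul]; exact hKK'
  have hc0 : 0 < c := one_pos.trans_le hc1
  have hKL : K * (c * L) = K' * L := by rw [hc]; field_simp
  refine ⟨c * L, fun y => W (c • y), by positivity, hC W hW c hc1, ?_, ?_, ?_, ?_, hKL⟩
  · obtain ⟨x₁, hx₁, hVx₁⟩ := hnear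
    exact ⟨x₁, hx₁.trans (le_mul_of_one_le_left hL.le hc1), hVx₁⟩
  · obtain ⟨y, y', hy, hy', hWy⟩ := hosc
    have hinv : c⁻¹ ≤ 1 := inv_le_one_of_one_le₀ hc1
    have hn : ∀ z : EuclideanSpace ℝ (Fin 3), ‖z‖ ≤ 1 → ‖c⁻¹ • z‖ ≤ 1 := fun z hz => by
      rw [norm_smul, Real.norm_of_nonneg (inv_nonneg.2 hc0.le)]
      exact (mul_le_mul hinv hz (norm_nonneg _) zero_le_one).trans_eq (one_mul 1)
    refine ⟨c⁻¹ • y, c⁻¹ • y', hn y hy, hn y' hy', ?_⟩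
    simpa only [smul_smul, mul_inv_cancel₀ hc0.ne', one_smul] using hWy
  · calc K * ν ≤ K' * ν := mul_le_mul_of_nonneg_right hKK' hν
      _ ≤ L * V := hRe
      _ ≤ c * L * V := by
        rw [mul_assoc]; exact le_mul_of_one_le_left (mul_nonneg hL.le hV.le) hc1
  · intro y hy
    have hy' : ‖c • y‖ ≤ K' := by
      rw [norm_smul, Real.norm_of_nonneg hc0.le]
      calc c * ‖y‖ ≤ c * K := mul_le_mul_of_nonneg_left hy hc0.le
        _ = K' := by rw [hc]; field_simp
    have h := hclose (c • y) hy'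
    have harg : x₀ + L • Q (c • y) = x₀ + (c * L) • Q y := by
      rw [Q.map_smul, smul_smul, mul_comm L c]
    rw [harg] at h
    exact h.trans (inv_anti₀ hK hKK')

/-! ### §2 The disjunctive split for late-floor witnesses -/

/-- **Late-floor witnesses of a disjunctive class split** (analogue of `TypeIICoreWitness.frequently_or` for the
late-floor currency).  Let `C`, `C'` be dilation-stable classes, `0 ≤ ν`.  If, with a common floor `r₀`, late level-`K`
witnesses of class `C ∨ C'` with core radius `≥ r₀` occur at every level `K > 0` frequently before `T`, then the same
holds for class `C` alone or for class `C'` alone (with the same floor).  Otherwise class `C` fails beyond `t₁` at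
level `K₁` and `C'` beyond `t₂` at `K₂`; a disjunctive witness at level `max K₁ K₂` after `max t₁ t₂` descends
(`witness_of_level_le`, core radius preserved) to a forbidden one. [folklore] -/
theorem lateFloorWitnesses_frequently_or
    {C C' : (EuclideanSpace ℝ (Fin 3) → EuclideanSpace ℝ (Fin 3)) → Prop}
    (hC : ∀ W, C W → ∀ c : ℝ, 1 ≤ c → C (fun y => W (c • y)))
    (hC' : ∀ W, C' W → ∀ c : ℝ, 1 ≤ c → C' (fun y => W (c • y)))
    {ν T r₀ : ℝ} {u : ℝ → EuclideanSpace ℝ (Fin 3) → EuclideanSpace ℝ (Fin 3)} (hν : 0 ≤ ν)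
    (h : ∀ K : ℝ, 0 < K → ∀ t₀ < T, ∃ t, t₀ < t ∧ t < T ∧
      ∃ (x₀ : EuclideanSpace ℝ (Fin 3)) (L V : ℝ)
        (Q : EuclideanSpace ℝ (Fin 3) ≃ₗᵢ[ℝ] EuclideanSpace ℝ (Fin 3))
        (W : EuclideanSpace ℝ (Fin 3) → EuclideanSpace ℝ (Fin 3)),
        0 < L ∧ 0 < V ∧ (C W ∨ C' W) ∧ (∀ x, ‖u t x‖ ≤ V) ∧
        (∃ x₁, dist x₁ x₀ ≤ L ∧ V ≤ 2 * ‖u t x₁‖) ∧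
        (∃ y y' : EuclideanSpace ℝ (Fin 3), ‖y‖ ≤ 1 ∧ ‖y'‖ ≤ 1 ∧ (4 : ℝ)⁻¹ ≤ ‖W y - W y'‖) ∧
        K * ν ≤ L * V ∧
        (∀ y : EuclideanSpace ℝ (Fin 3), ‖y‖ ≤ K →
          ‖V⁻¹ • Q.symm (u t (x₀ + L • Q y)) - W y‖ ≤ K⁻¹) ∧
        (T - t) * V ≤ K * L ∧ r₀ ≤ K * L) :
    (∀ K : ℝ, 0 < K → ∀ t₀ < T, ∃ t, t₀ < t ∧ t < T ∧
      ∃ (x₀ : EuclideanSpace ℝ (Fin 3)) (L V : ℝ)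
        (Q : EuclideanSpace ℝ (Fin 3) ≃ₗᵢ[ℝ] EuclideanSpace ℝ (Fin 3))
        (W : EuclideanSpace ℝ (Fin 3) → EuclideanSpace ℝ (Fin 3)),
        0 < L ∧ 0 < V ∧ C W ∧ (∀ x, ‖u t x‖ ≤ V) ∧
        (∃ x₁, dist x₁ x₀ ≤ L ∧ V ≤ 2 * ‖u t x₁‖) ∧
        (∃ y y' : EuclideanSpace ℝ (Fin 3), ‖y‖ ≤ 1 ∧ ‖y'‖ ≤ 1 ∧ (4 : ℝ)⁻¹ ≤ ‖W y - W y'‖) ∧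
        K * ν ≤ L * V ∧
        (∀ y : EuclideanSpace ℝ (Fin 3), ‖y‖ ≤ K →
          ‖V⁻¹ • Q.symm (u t (x₀ + L • Q y)) - W y‖ ≤ K⁻¹) ∧
        (T - t) * V ≤ K * L ∧ r₀ ≤ K * L) ∨
    (∀ K : ℝ, 0 < K → ∀ t₀ < T, ∃ t, t₀ < t ∧ t < T ∧
      ∃ (x₀ : EuclideanSpace ℝ (Fin 3)) (L V : ℝ)
        (Q : EuclideanSpace ℝ (Fin 3) ≃ₗᵢ[ℝ] EuclideanSpace ℝ (Fin 3))
        (W : EuclideanSpace ℝ (Fin 3) → EuclideanSpace ℝ (Fin 3)),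
        0 < L ∧ 0 < V ∧ C' W ∧ (∀ x, ‖u t x‖ ≤ V) ∧
        (∃ x₁, dist x₁ x₀ ≤ L ∧ V ≤ 2 * ‖u t x₁‖) ∧
        (∃ y y' : EuclideanSpace ℝ (Fin 3), ‖y‖ ≤ 1 ∧ ‖y'‖ ≤ 1 ∧ (4 : ℝ)⁻¹ ≤ ‖W y - W y'‖) ∧
        K * ν ≤ L * V ∧
        (∀ y : EuclideanSpace ℝ (Fin 3), ‖y‖ ≤ K →
          ‖V⁻¹ • Q.symm (u t (x₀ + L • Q y)) - W y‖ ≤ K⁻¹) ∧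
        (T - t) * V ≤ K * L ∧ r₀ ≤ K * L) := by
  by_contra hcon
  push Not at hcon
  obtain ⟨⟨K₁, hK₁, t₁, ht₁, h₁⟩, ⟨K₂, hK₂, t₂, ht₂, h₂⟩⟩ := hcon
  obtain ⟨t, ht₀, htT, x₀, L, V, Q, W, hL, hV, hW, hbd, hnear, hosc, hRe, hclose, hlate, hfloor⟩ :=
    h (max K₁ K₂) (lt_max_of_lt_left hK₁) (max t₁ t₂) (max_lt ht₁ ht₂)
  rcases hW with hW | hW
  · obtain ⟨L', W', hL', hW', hnear', hosc', hRe', hclose', hKL⟩ :=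
      witness_of_level_le hC hν hK₁ (le_max_left K₁ K₂) hL hV hW hnear hosc hRe hclose
    have hlt := h₁ t ((le_max_left _ _).trans_lt ht₀) htT x₀ L' V Q W' hL' hV hW' hbd hnear' hosc' hRe'
      hclose' (by rw [hKL]; exact hlate)
    rw [hKL] at hlt
    exact absurd hfloor (not_le.2 hlt)
  · obtain ⟨L', W', hL', hW', hnear', hosc', hRe', hclose', hKL⟩ :=
      witness_of_level_le hC' hν hK₂ (le_max_right K₁ K₂) hL hV hW hnear hosc hRe hclose
    have hlt := h₂ t ((le_max_right _ _).trans_lt ht₀) htT x₀ L' V Q W' hL' hV hW' hbd hnear' hosc' hRe'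
      hclose' (by rw [hKL]; exact hlate)
    rw [hKL] at hlt
    exact absurd hfloor (not_le.2 hlt)

/-! ### §3 The late-floor exclusion half, assembled -/

/-- **Late-floor core witnesses (axisymmetric or columnar) are excluded by the two shadowing stubs.**  Assume the
conclusion of the landed axisymmetric transfer stub (`hComp` = `AxisymComparisonFlow.stub_axisymComparisonFlowOfAX hAX`,
p830482) and the statements of the registered shadowing stubs of the two exclusion lines (`hShadowAx` =
`stub_axisymShadowing`, `hShadowCol` = `stub_columnarShadowing`, verbatim).  Then no maximal smooth solution on `[0,T)`,
Leray–Hopf from a rapidly decaying datum, carries — with a common core-radius floor `r₀` — LATE level-`K` core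
witnesses of the disjunctive class "axisymmetric or columnar" at every level `K > 0` frequently before `T`.  (Split by
`lateFloorWitnesses_frequently_or`; the axisymmetric branch is `monopoleCoreExclusion_lateFloor_of_shadowing`, the
columnar branch `columnarCoreExclusion_lateFloor_of_shadowing` with the landed construction p829857.) [folklore] -/
theorem lateFloorCoreExclusion_of_shadowings
    (hComp : ∃ A : ℝ, 0 < A ∧
      ∀ (ν T t K : ℝ) (u : ℝ → EuclideanSpace ℝ (Fin 3) → EuclideanSpace ℝ (Fin 3))
        (p : ℝ → EuclideanSpace ℝ (Fin 3) → ℝ),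
        0 < ν → 0 < T → IsClassicalNSSolutionOn (Ico 0 T) ν 0 u p → IsLerayHopfOn T ν 0 (u 0) u →
        HasRapidSpatialDecay (u 0) → 0 < t → t < T → 1 ≤ K →
        ∀ (x₀ : EuclideanSpace ℝ (Fin 3)) (L V : ℝ)
          (Q : EuclideanSpace ℝ (Fin 3) ≃ₗᵢ[ℝ] EuclideanSpace ℝ (Fin 3))
          (W : EuclideanSpace ℝ (Fin 3) → EuclideanSpace ℝ (Fin 3)),
          0 < L → 0 < V → IsAxisymmetric W → (∀ x, ‖u t x‖ ≤ V) → K * ν ≤ L * V →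
          (∀ y : EuclideanSpace ℝ (Fin 3), ‖y‖ ≤ K →
            ‖V⁻¹ • Q.symm (u t (x₀ + L • Q y)) - W y‖ ≤ K⁻¹) →
          ∃ (v : ℝ → EuclideanSpace ℝ (Fin 3) → EuclideanSpace ℝ (Fin 3))
            (q : ℝ → EuclideanSpace ℝ (Fin 3) → ℝ) (Mv : ℝ),
            IsClassicalNSSolutionOn (Icc t T) ν 0 v q ∧
            (∀ s ∈ Icc t T, IsAxisymmetric (fun y : EuclideanSpace ℝ (Fin 3) => Q.symm (v s (x₀ + Q y)))) ∧
            (∀ s ∈ Icc t T, ∀ x, ‖v s x‖ ≤ Mv) ∧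
            (∀ x ∈ ball x₀ (K * L), ‖u t x - v t x‖ ≤ A * V / K))
    (hShadowAx : ∀ A : ℝ, 0 < A → ∃ K₀ : ℝ, 1 ≤ K₀ ∧ ∀ K : ℝ, K₀ ≤ K →
      ∀ (ν T t : ℝ) (u : ℝ → EuclideanSpace ℝ (Fin 3) → EuclideanSpace ℝ (Fin 3))
        (p : ℝ → EuclideanSpace ℝ (Fin 3) → ℝ),
        0 < ν → 0 < T → IsClassicalNSSolutionOn (Ico 0 T) ν 0 u p → IsLerayHopfOn T ν 0 (u 0) u →
        HasRapidSpatialDecay (u 0) → 0 < t → t < T →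
        ∀ (x₀ : EuclideanSpace ℝ (Fin 3)) (L V : ℝ)
          (Q : EuclideanSpace ℝ (Fin 3) ≃ₗᵢ[ℝ] EuclideanSpace ℝ (Fin 3)),
          0 < L → 0 < V → (∀ x, ‖u t x‖ ≤ V) →
          (∃ x₁, dist x₁ x₀ ≤ L ∧ V ≤ 2 * ‖u t x₁‖) → K * ν ≤ L * V → (T - t) * V ≤ K * L →
          ∀ (v : ℝ → EuclideanSpace ℝ (Fin 3) → EuclideanSpace ℝ (Fin 3))
            (q : ℝ → EuclideanSpace ℝ (Fin 3) → ℝ) (Mv : ℝ),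
            IsClassicalNSSolutionOn (Icc t T) ν 0 v q →
            (∀ s ∈ Icc t T, IsAxisymmetric (fun y : EuclideanSpace ℝ (Fin 3) => Q.symm (v s (x₀ + Q y)))) →
            (∀ s ∈ Icc t T, ∀ x, ‖v s x‖ ≤ Mv) →
            (∀ x ∈ ball x₀ (K * L), ‖u t x - v t x‖ ≤ A * V / K) →
            ∃ M : ℝ, ∀ s ∈ Ico t T, ∀ x ∈ ball x₀ (K * L / 2), ‖u s x‖ ≤ M)
    (hShadowCol : ∀ A : ℝ, 0 < A → ∃ K₀ : ℝ, 1 ≤ K₀ ∧ ∀ K : ℝ, K₀ ≤ K →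
      ∀ (ν T t : ℝ) (u : ℝ → EuclideanSpace ℝ (Fin 3) → EuclideanSpace ℝ (Fin 3))
        (p : ℝ → EuclideanSpace ℝ (Fin 3) → ℝ),
        0 < ν → 0 < T → IsClassicalNSSolutionOn (Ico 0 T) ν 0 u p → IsLerayHopfOn T ν 0 (u 0) u →
        HasRapidSpatialDecay (u 0) → 0 < t → t < T →
        ∀ (x₀ : EuclideanSpace ℝ (Fin 3)) (L V : ℝ)
          (Q : EuclideanSpace ℝ (Fin 3) ≃ₗᵢ[ℝ] EuclideanSpace ℝ (Fin 3)),
          0 < L → 0 < V → (∀ x, ‖u t x‖ ≤ V) →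
          (∃ x₁, dist x₁ x₀ ≤ L ∧ V ≤ 2 * ‖u t x₁‖) → K * ν ≤ L * V → (T - t) * V ≤ K * L →
          ∀ (v : ℝ → EuclideanSpace ℝ (Fin 3) → EuclideanSpace ℝ (Fin 3))
            (q : ℝ → EuclideanSpace ℝ (Fin 3) → ℝ) (Mv : ℝ),
            IsClassicalNSSolutionOn (Icc t T) ν 0 v q →
            (∀ s ∈ Icc t T, ∀ (x : EuclideanSpace ℝ (Fin 3)) (τ : ℝ), v s (x + τ • Q eZ) = v s x) →
            (∀ s ∈ Icc t T, ∀ x, ‖v s x‖ ≤ Mv) →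
            (∀ x ∈ ball x₀ (K * L / 2), ‖u t x - v t x‖ ≤ A * V / K) →
            ∃ M : ℝ, ∀ s ∈ Ico t T, ∀ x ∈ ball x₀ (3 * K * L / 8), ‖u s x‖ ≤ M)
    {ν T : ℝ} {u : ℝ → EuclideanSpace ℝ (Fin 3) → EuclideanSpace ℝ (Fin 3)}
    {p : ℝ → EuclideanSpace ℝ (Fin 3) → ℝ}
    (hν : 0 < ν) (hT : 0 < T) (hmax : IsMaximalSmoothSolution ν 0 u p T)
    (hLH : IsLerayHopfOn T ν 0 (u 0) u) (hdec : HasRapidSpatialDecay (u 0))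
    (hwl : ∃ r₀ : ℝ, 0 < r₀ ∧ ∀ K : ℝ, 0 < K → ∀ t₀ < T, ∃ t, t₀ < t ∧ t < T ∧
      ∃ (x₀ : EuclideanSpace ℝ (Fin 3)) (L V : ℝ)
        (Q : EuclideanSpace ℝ (Fin 3) ≃ₗᵢ[ℝ] EuclideanSpace ℝ (Fin 3))
        (W : EuclideanSpace ℝ (Fin 3) → EuclideanSpace ℝ (Fin 3)),
        0 < L ∧ 0 < V ∧ (IsAxisymmetric W ∨ IsColumnar W) ∧ (∀ x, ‖u t x‖ ≤ V) ∧
        (∃ x₁, dist x₁ x₀ ≤ L ∧ V ≤ 2 * ‖u t x₁‖) ∧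
        (∃ y y' : EuclideanSpace ℝ (Fin 3), ‖y‖ ≤ 1 ∧ ‖y'‖ ≤ 1 ∧ (4 : ℝ)⁻¹ ≤ ‖W y - W y'‖) ∧
        K * ν ≤ L * V ∧
        (∀ y : EuclideanSpace ℝ (Fin 3), ‖y‖ ≤ K →
          ‖V⁻¹ • Q.symm (u t (x₀ + L • Q y)) - W y‖ ≤ K⁻¹) ∧
        (T - t) * V ≤ K * L ∧ r₀ ≤ K * L) :
    False := by
  obtain ⟨r₀, hr₀, h⟩ := hwl
  rcases lateFloorWitnesses_frequently_or (C := IsAxisymmetric) (C' := IsColumnar)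
      (fun _ hW c _ => isAxisymmetric_dilate hW c) (fun _ hW c _ => isColumnar_dilate hW c) hν.le h with
    hax | hcol
  · exact monopoleCoreExclusion_lateFloor_of_shadowing hComp hShadowAx hν hT hmax hLH hdec ⟨r₀, hr₀, hax⟩
  · exact columnarCoreExclusion_lateFloor_of_shadowing hShadowCol hν hT hmax hLH hdec ⟨r₀, hr₀, hcol⟩

end CoreExclusionAnchor

end Summit.NavierStokesRegularity.NavierStokesRegularity.Theorems

end
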